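import Mathlib
import Summits.Ventures.PercRepro2.K5HyperCoeffs
import Summits.Ventures.PercRepro2.K5HyperI

/-!
# THE (i)-SIDE STAR COMPARISONS AS COEFFICIENT INEQUALITIES AT EVERY `K₅` PROFILE
(blind cell PercRepro2, typer-1 g10; mine-1 §23.5)

The placement sums of `K5HyperI.lean` are encodings of the corresponding sums of masked triple counts
(`sumT1_eq`, `sumT2_eq`, `sumT1e1_eq`, `sumE3_eq` — generic in the pattern kernel, `csumT1`, …), with
`cPosOnI` / `cNegOnI` the masked counts of the cleared (i) tables.  The coefficients are below `KB3`, so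
`le_of_certLE` reads the comparisons off the certificates:

* **`cNegMI_le_cPosMI`**: `M-(i) ≥ 0` at every `K₅` profile — `N⁽ⁱ⁾(H + T(1) + e(1)) ≥ N⁽ⁱ⁾(H + T(1))`, the
  (i) count being `cNeg − cPos`;
* **`cNegTvTI_le_cPosTvTI`**: `TvT-(i) ≥ 0`;
* **`cT1I_le`**, **`cT2I_le`**: `N⁽ⁱ⁾(H + T(1)) ≥ 0`, `N⁽ⁱ⁾(H + T(2)) ≥ 0`.
-/

namespace Summit.Ventures.PercRepro2

namespace K5

/-! ## The placement sums of coefficient functions -/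

section GenericCoeffs

variable (g : (Fin 10 → Bool) → (Fin 10 → Bool) → (Fin 10 → Bool) → (Fin 10 → Fin 4) → ℕ)

/-- `D` open in exactly one copy. -/
def csumT1 (D : Fin 10 → Bool) (k : Fin 10 → Fin 4) : ℕ :=
  g D mNone mNone k + g mNone D mNone k + g mNone mNone D k

/-- `D` open in exactly two copies. -/
def csumT2 (D : Fin 10 → Bool) (k : Fin 10 → Fin 4) : ℕ :=
  g D D mNone k + g D mNone D k + g mNone D D k

/-- `D` in one copy and `P` in one copy. -/
def csumT1e1 (D P : Fin 10 → Bool) (k : Fin 10 → Fin 4) : ℕ :=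
  g (mOr D P) mNone mNone k + g D P mNone k + g D mNone P k + g P D mNone k + g mNone (mOr D P) mNone k +
    g mNone D P k + g P mNone D k + g mNone P D k + g mNone mNone (mOr D P) k

/-- Three edge sets each in one copy, `P₁` in the copy `0`. -/
def csumE3a (P₁ P₂ P₃ : Fin 10 → Bool) (k : Fin 10 → Fin 4) : ℕ :=
  g (mOr (mOr P₁ P₂) P₃) mNone mNone k + g (mOr P₁ P₂) P₃ mNone k + g (mOr P₁ P₂) mNone P₃ k +
    g (mOr P₁ P₃) P₂ mNone k + g P₁ (mOr P₂ P₃) mNone k + g P₁ P₂ P₃ k + g (mOr P₁ P₃) mNone P₂ k +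
    g P₁ P₃ P₂ k + g P₁ mNone (mOr P₂ P₃) k

/-- `P₁` in the copy `1`. -/
def csumE3b (P₁ P₂ P₃ : Fin 10 → Bool) (k : Fin 10 → Fin 4) : ℕ :=
  g (mOr P₂ P₃) P₁ mNone k + g P₂ (mOr P₁ P₃) mNone k + g P₂ P₁ P₃ k + g P₃ (mOr P₁ P₂) mNone k +
    g mNone (mOr (mOr P₁ P₂) P₃) mNone k + g mNone (mOr P₁ P₂) P₃ k + g P₃ P₁ P₂ k +
    g mNone (mOr P₁ P₃) P₂ k + g mNone P₁ (mOr P₂ P₃) k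

/-- `P₁` in the copy `2`. -/
def csumE3c (P₁ P₂ P₃ : Fin 10 → Bool) (k : Fin 10 → Fin 4) : ℕ :=
  g (mOr P₂ P₃) mNone P₁ k + g P₂ P₃ P₁ k + g P₂ mNone (mOr P₁ P₃) k + g P₃ P₂ P₁ k +
    g mNone (mOr P₂ P₃) P₁ k + g mNone P₂ (mOr P₁ P₃) k + g P₃ mNone (mOr P₁ P₂) k +
    g mNone P₃ (mOr P₁ P₂) k + g mNone mNone (mOr (mOr P₁ P₂) P₃) k

/-- Three edge sets each in one copy (`27` placements). -/
def csumE3 (P₁ P₂ P₃ : Fin 10 → Bool) (k : Fin 10 → Fin 4) : ℕ :=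
  csumE3a g P₁ P₂ P₃ k + csumE3b g P₁ P₂ P₃ k + csumE3c g P₁ P₂ P₃ k

variable (f : (Fin 10 → Bool) → (Fin 10 → Bool) → (Fin 10 → Bool) → ℕ)
  (hfg : ∀ S₁ S₂ S₃, f S₁ S₂ S₃ = ∑ k, g S₁ S₂ S₃ k * KB3 ^ idx4 k)

include hfg in
/-- The encoding of `sumT1`. -/
lemma sumT1_eq (D : Fin 10 → Bool) : sumT1 f D = ∑ k, csumT1 g D k * KB3 ^ idx4 k := by
  unfold sumT1 csumT1
  simp only [hfg, sum_add_mulB]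

include hfg in
/-- The encoding of `sumT2`. -/
lemma sumT2_eq (D : Fin 10 → Bool) : sumT2 f D = ∑ k, csumT2 g D k * KB3 ^ idx4 k := by
  unfold sumT2 csumT2
  simp only [hfg, sum_add_mulB]

include hfg in
/-- The encoding of `sumT1e1`. -/
lemma sumT1e1_eq (D P : Fin 10 → Bool) : sumT1e1 f D P = ∑ k, csumT1e1 g D P k * KB3 ^ idx4 k := by
  unfold sumT1e1 csumT1e1
  simp only [hfg, sum_add_mulB]

include hfg in
/-- The encoding of `sumE3`. -/
lemma sumE3_eq (P₁ P₂ P₃ : Fin 10 → Bool) :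
    sumE3 f P₁ P₂ P₃ = ∑ k, csumE3 g P₁ P₂ P₃ k * KB3 ^ idx4 k := by
  unfold sumE3 sumE3a sumE3b sumE3c csumE3 csumE3a csumE3b csumE3c
  simp only [hfg, sum_add_mulB]

variable (c : ℕ) (hg : ∀ S₁ S₂ S₃ k, g S₁ S₂ S₃ k ≤ c)

include hg in
/-- Three terms. -/
lemma csumT1_le (D : Fin 10 → Bool) (k : Fin 10 → Fin 4) : csumT1 g D k ≤ 3 * c := by
  unfold csumT1
  have := hg D mNone mNone k; have := hg mNone D mNone k; have := hg mNone mNone D k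
  omega

include hg in
/-- Three terms. -/
lemma csumT2_le (D : Fin 10 → Bool) (k : Fin 10 → Fin 4) : csumT2 g D k ≤ 3 * c := by
  unfold csumT2
  have := hg D D mNone k; have := hg D mNone D k; have := hg mNone D D k
  omega

include hg in
/-- Nine terms. -/
lemma csumT1e1_le (D P : Fin 10 → Bool) (k : Fin 10 → Fin 4) : csumT1e1 g D P k ≤ 9 * c := by
  unfold csumT1e1
  have := hg (mOr D P) mNone mNone k; have := hg D P mNone k; have := hg D mNone P k
  have := hg P D mNone k; have := hg mNone (mOr D P) mNone k; have := hg mNone D P k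
  have := hg P mNone D k; have := hg mNone P D k; have := hg mNone mNone (mOr D P) k
  omega

include hg in
/-- Nine terms. -/
lemma csumE3a_le (P₁ P₂ P₃ : Fin 10 → Bool) (k : Fin 10 → Fin 4) : csumE3a g P₁ P₂ P₃ k ≤ 9 * c := by
  unfold csumE3a
  have := hg (mOr (mOr P₁ P₂) P₃) mNone mNone k; have := hg (mOr P₁ P₂) P₃ mNone k
  have := hg (mOr P₁ P₂) mNone P₃ k; have := hg (mOr P₁ P₃) P₂ mNone k; have := hg P₁ (mOr P₂ P₃) mNone k
  have := hg P₁ P₂ P₃ k; have := hg (mOr P₁ P₃) mNone P₂ k; have := hg P₁ P₃ P₂ k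
  have := hg P₁ mNone (mOr P₂ P₃) k
  omega

include hg in
/-- Nine terms. -/
lemma csumE3b_le (P₁ P₂ P₃ : Fin 10 → Bool) (k : Fin 10 → Fin 4) : csumE3b g P₁ P₂ P₃ k ≤ 9 * c := by
  unfold csumE3b
  have := hg (mOr P₂ P₃) P₁ mNone k; have := hg P₂ (mOr P₁ P₃) mNone k; have := hg P₂ P₁ P₃ k
  have := hg P₃ (mOr P₁ P₂) mNone k; have := hg mNone (mOr (mOr P₁ P₂) P₃) mNone k
  have := hg mNone (mOr P₁ P₂) P₃ k; have := hg P₃ P₁ P₂ k; have := hg mNone (mOr P₁ P₃) P₂ k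
  have := hg mNone P₁ (mOr P₂ P₃) k
  omega

include hg in
/-- Nine terms. -/
lemma csumE3c_le (P₁ P₂ P₃ : Fin 10 → Bool) (k : Fin 10 → Fin 4) : csumE3c g P₁ P₂ P₃ k ≤ 9 * c := by
  unfold csumE3c
  have := hg (mOr P₂ P₃) mNone P₁ k; have := hg P₂ P₃ P₁ k; have := hg P₂ mNone (mOr P₁ P₃) k
  have := hg P₃ P₂ P₁ k; have := hg mNone (mOr P₂ P₃) P₁ k; have := hg mNone P₂ (mOr P₁ P₃) k
  have := hg P₃ mNone (mOr P₁ P₂) k; have := hg mNone P₃ (mOr P₁ P₂) k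
  have := hg mNone mNone (mOr (mOr P₁ P₂) P₃) k
  omega

include hg in
/-- Twenty-seven terms. -/
lemma csumE3_le (P₁ P₂ P₃ : Fin 10 → Bool) (k : Fin 10 → Fin 4) : csumE3 g P₁ P₂ P₃ k ≤ 27 * c := by
  unfold csumE3
  have := csumE3a_le g c hg P₁ P₂ P₃ k
  have := csumE3b_le g c hg P₁ P₂ P₃ k
  have := csumE3c_le g c hg P₁ P₂ P₃ k
  omega

end GenericCoeffs

/-! ## The (i) tables -/

section CoeffsI

/-- The positive products of the cleared (i) on a pattern. -/
def cPosOnI (S₁ S₂ S₃ : Fin 10 → Bool) (k : Fin 10 → Fin 4) : ℕ :=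
  cOn tABOL tQ tPD S₁ S₂ S₃ k + cOn tQBL tPDoU tA S₁ S₂ S₃ k

/-- The negative products of the cleared (i) on a pattern. -/
def cNegOnI (S₁ S₂ S₃ : Fin 10 → Bool) (k : Fin 10 → Fin 4) : ℕ :=
  cOn tQBL tAO tPD S₁ S₂ S₃ k + cOn tABL tPDoU tQ S₁ S₂ S₃ k

/-- `posOnI` encodes `cPosOnI`. -/
lemma posOnI_eq (S₁ S₂ S₃ : Fin 10 → Bool) : posOnI S₁ S₂ S₃ = ∑ k, cPosOnI S₁ S₂ S₃ k * KB3 ^ idx4 k := by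
  unfold posOnI
  rw [kron3_mul_mul, kron3_mul_mul, sum_add_mulB]
  rfl

/-- `negOnI` encodes `cNegOnI`. -/
lemma negOnI_eq (S₁ S₂ S₃ : Fin 10 → Bool) : negOnI S₁ S₂ S₃ = ∑ k, cNegOnI S₁ S₂ S₃ k * KB3 ^ idx4 k := by
  unfold negOnI
  rw [kron3_mul_mul, kron3_mul_mul, sum_add_mulB]
  rfl

/-- Two masked counts. -/
lemma cPosOnI_le (S₁ S₂ S₃ : Fin 10 → Bool) (k : Fin 10 → Fin 4) : cPosOnI S₁ S₂ S₃ k ≤ 2 * 59049 := by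
  unfold cPosOnI
  have := cOn_le tABOL tQ tPD S₁ S₂ S₃ k
  have := cOn_le tQBL tPDoU tA S₁ S₂ S₃ k
  omega

/-- Two masked counts. -/
lemma cNegOnI_le (S₁ S₂ S₃ : Fin 10 → Bool) (k : Fin 10 → Fin 4) : cNegOnI S₁ S₂ S₃ k ≤ 2 * 59049 := by
  unfold cNegOnI
  have := cOn_le tQBL tAO tPD S₁ S₂ S₃ k
  have := cOn_le tABL tPDoU tQ S₁ S₂ S₃ k
  omega

/-- The positive side of `M-(i)`: `N(H+T(1)+e(1))⁻ + N(H+T(1))⁺`. -/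
def cPosMI (D P : Fin 10 → Bool) (k : Fin 10 → Fin 4) : ℕ := csumT1e1 cNegOnI D P k + csumT1 cPosOnI D k

/-- The negative side of `M-(i)`. -/
def cNegMI (D P : Fin 10 → Bool) (k : Fin 10 → Fin 4) : ℕ := csumT1e1 cPosOnI D P k + csumT1 cNegOnI D k

/-- The positive side of `TvT-(i)`: `N(H+△(1,1,1))⁻ + N(H+T(1))⁺`. -/
def cPosTvTI (a b c : ℕ) (k : Fin 10 → Fin 4) : ℕ :=
  csumE3 cNegOnI (pairMask a b) (pairMask a c) (pairMask b c) k + csumT1 cPosOnI (triMask a b c) k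

/-- The negative side of `TvT-(i)`. -/
def cNegTvTI (a b c : ℕ) (k : Fin 10 → Fin 4) : ℕ :=
  csumE3 cPosOnI (pairMask a b) (pairMask a c) (pairMask b c) k + csumT1 cNegOnI (triMask a b c) k

/-- `kPosMI` encodes `cPosMI`. -/
lemma kPosMI_eq (D P : Fin 10 → Bool) : kPosMI D P = ∑ k, cPosMI D P k * KB3 ^ idx4 k := by
  unfold kPosMI
  rw [sumT1e1_eq cNegOnI negOnI negOnI_eq, sumT1_eq cPosOnI posOnI posOnI_eq, sum_add_mulB]
  rfl

/-- `kNegMI` encodes `cNegMI`. -/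
lemma kNegMI_eq (D P : Fin 10 → Bool) : kNegMI D P = ∑ k, cNegMI D P k * KB3 ^ idx4 k := by
  unfold kNegMI
  rw [sumT1e1_eq cPosOnI posOnI posOnI_eq, sumT1_eq cNegOnI negOnI negOnI_eq, sum_add_mulB]
  rfl

/-- `kPosTvTI` encodes `cPosTvTI`. -/
lemma kPosTvTI_eq (a b c : ℕ) : kPosTvTI a b c = ∑ k, cPosTvTI a b c k * KB3 ^ idx4 k := by
  unfold kPosTvTI
  rw [sumE3_eq cNegOnI negOnI negOnI_eq, sumT1_eq cPosOnI posOnI posOnI_eq, sum_add_mulB]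
  rfl

/-- `kNegTvTI` encodes `cNegTvTI`. -/
lemma kNegTvTI_eq (a b c : ℕ) : kNegTvTI a b c = ∑ k, cNegTvTI a b c k * KB3 ^ idx4 k := by
  unfold kNegTvTI
  rw [sumE3_eq cPosOnI posOnI posOnI_eq, sumT1_eq cNegOnI negOnI negOnI_eq, sum_add_mulB]
  rfl

/-- The `M-(i)` coefficients are below `KB3`. -/
lemma cPosMI_lt (D P : Fin 10 → Bool) (k : Fin 10 → Fin 4) : cPosMI D P k < KB3 := by
  unfold cPosMI; rw [KB3_val]
  have := csumT1e1_le cNegOnI (2 * 59049) cNegOnI_le D P k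
  have := csumT1_le cPosOnI (2 * 59049) cPosOnI_le D k
  omega

/-- The `M-(i)` coefficients are below `KB3`. -/
lemma cNegMI_lt (D P : Fin 10 → Bool) (k : Fin 10 → Fin 4) : cNegMI D P k < KB3 := by
  unfold cNegMI; rw [KB3_val]
  have := csumT1e1_le cPosOnI (2 * 59049) cPosOnI_le D P k
  have := csumT1_le cNegOnI (2 * 59049) cNegOnI_le D k
  omega

/-- The `TvT-(i)` coefficients are below `KB3`. -/
lemma cPosTvTI_lt (a b c : ℕ) (k : Fin 10 → Fin 4) : cPosTvTI a b c k < KB3 := by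
  unfold cPosTvTI; rw [KB3_val]
  have := csumE3_le cNegOnI (2 * 59049) cNegOnI_le (pairMask a b) (pairMask a c) (pairMask b c) k
  have := csumT1_le cPosOnI (2 * 59049) cPosOnI_le (triMask a b c) k
  omega

/-- The `TvT-(i)` coefficients are below `KB3`. -/
lemma cNegTvTI_lt (a b c : ℕ) (k : Fin 10 → Fin 4) : cNegTvTI a b c k < KB3 := by
  unfold cNegTvTI; rw [KB3_val]
  have := csumE3_le cPosOnI (2 * 59049) cPosOnI_le (pairMask a b) (pairMask a c) (pairMask b c) k
  have := csumT1_le cNegOnI (2 * 59049) cNegOnI_le (triMask a b c) k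
  omega

/-- **`M-(i) ≥ 0` at every `K₅` profile**, from its certificate. -/
theorem cNegMI_le_cPosMI (D P : Fin 10 → Bool) (hc : CertLE (kNegMI D P) (kPosMI D P)) (k : Fin 10 → Fin 4) :
    cNegMI D P k ≤ cPosMI D P k :=
  le_of_certLE (cPosMI D P) (cNegMI D P) (cPosMI_lt D P) (cNegMI_lt D P) (kPosMI_eq D P) (kNegMI_eq D P) hc k

/-- **`TvT-(i) ≥ 0` at every `K₅` profile**, from its certificate. -/
theorem cNegTvTI_le_cPosTvTI (a b c : ℕ) (hc : CertLE (kNegTvTI a b c) (kPosTvTI a b c))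
    (k : Fin 10 → Fin 4) : cNegTvTI a b c k ≤ cPosTvTI a b c k :=
  le_of_certLE (cPosTvTI a b c) (cNegTvTI a b c) (cPosTvTI_lt a b c) (cNegTvTI_lt a b c)
    (kPosTvTI_eq a b c) (kNegTvTI_eq a b c) hc k

/-- **`N⁽ⁱ⁾(H + D(1)) ≥ 0` at every `K₅` profile**, from its certificate. -/
theorem cT1I_le (D : Fin 10 → Bool) (hc : CertLE (sumT1 posOnI D) (sumT1 negOnI D)) (k : Fin 10 → Fin 4) :
    csumT1 cPosOnI D k ≤ csumT1 cNegOnI D k :=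
  le_of_certLE (csumT1 cNegOnI D) (csumT1 cPosOnI D)
    (fun k => by rw [KB3_val]; have := csumT1_le cNegOnI (2 * 59049) cNegOnI_le D k; omega)
    (fun k => by rw [KB3_val]; have := csumT1_le cPosOnI (2 * 59049) cPosOnI_le D k; omega)
    (sumT1_eq cNegOnI negOnI negOnI_eq D) (sumT1_eq cPosOnI posOnI posOnI_eq D) hc k

/-- **`N⁽ⁱ⁾(H + D(2)) ≥ 0` at every `K₅` profile**, from its certificate. -/
theorem cT2I_le (D : Fin 10 → Bool) (hc : CertLE (sumT2 posOnI D) (sumT2 negOnI D)) (k : Fin 10 → Fin 4) :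
    csumT2 cPosOnI D k ≤ csumT2 cNegOnI D k :=
  le_of_certLE (csumT2 cNegOnI D) (csumT2 cPosOnI D)
    (fun k => by rw [KB3_val]; have := csumT2_le cNegOnI (2 * 59049) cNegOnI_le D k; omega)
    (fun k => by rw [KB3_val]; have := csumT2_le cPosOnI (2 * 59049) cPosOnI_le D k; omega)
    (sumT2_eq cNegOnI negOnI negOnI_eq D) (sumT2_eq cPosOnI posOnI posOnI_eq D) hc k

end CoeffsI

end K5

end Summit.Ventures.PercRepro2
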